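import Summits.QuantumFields.YangMills.Theorems.UnitScaleTiltProp7IterLinStructure
import HarnessLib

/-!
# Route `UnitScaleTilt`, crux K1 «MinimiserStabilityRegPr» (stmt-QuantumFields-19200), registered stub `stub_prop7From14` (leaf V3 «Prop 7 from a background (14)») —
# **THE COMB-MEAN GAUGE: inside print's group (4) (`λ = 0` at the block centres) every fine field can be regauged so that the TRUE linearised (0.4) average is
# EXACTLY `L` times the STRAIGHT block average of [Balaban1984PropagatorsI] (1.11)** (`exists_combGauge_linAvg_eq_smul_bondAvg`, flat background, one step)

Cell `ym3-torus` ∕ fleet seat `ym-ust-19200-p1` (gen 5).  WHY.  The lineage's «model constraint» (comb-transported STRAIGHT contour averages: p451004/p474466/p483802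
engine, p519482/p520587/p521440 fibre, p528174–p534332 assembly) differs from the (0.4) average of record, whose linearisation at the flat background is `linAvg =
L·bondAvg − d(combMean)` (p2 lineage `BlockAveragingEMLLinearised.linAvg_eq_bondAvg_sub_grad_combMean`; k-fold `Q^{(k)} = L^kQ_k − dΛ_k`, p526009): the difference is
a COARSE PURE GAUGE built from the comb means `λ̄_Y(y)` (mean over block sites and orderings of the signed sums of `Y` along the (0.3) staircases from the centre).
THIS FILE: the comb mean of a fine pure gauge `dλ` is `Q′λ − λ∘emb` (block mean minus centre value, `combMean_grad`), so for EVERY `Y` the gauge function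
`λ_Y := −(L^d/(L^d − 1))·λ̄_Y∘blockOf` off the centres, `0` at the centres — an element of the Lie algebra of print's group (4) `u↓ = 1` — kills the comb mean:
`λ̄_{Y + dλ_Y} = 0`; and since `linAvg` is invariant under (4) (`linAvg(dλ) = d(λ∘emb) = 0`), **`linAvg Y = L·bondAvg(Y + dλ_Y)` exactly**.  So, at the flat background
and for one step, the model constraint IS the true linearised constraint read in a gauge reachable inside the group (4) — the coarse pure gauge `dΛ` is a gauge
ARTEFACT, not a defect of the model (CARD-19200-V3-g5 «located structural note»).  What the gauge does NOT do: it is not a Landau-type gauge, so the coercivity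
engine (which pays `Σ‖D^*Y‖²` ∕ `‖R∂^*Y‖²`) does not apply in it — the gauge change to print's `R`-slice inside (4) with estimates is [B8] Thm 2 (V3-A).

WHAT IS PROVED (sorry-free, no definition; [folklore] bookkeeping on the tree's `walkSum`/`combMean`/`linAvg`): `walkSum_add`, `combMean_add`, `emb_eq_blockSite`,
`combMean_grad` (`λ̄_{dλ}(y) = L^{−d}Σ_{x∈B(y)}λ(x) − λ(emb y)`), `combMean_blockConst_off_centre` (the comb mean of `dλ` for `λ` block-constant off the centres and `0` at
the centres is `(1 − L^{−d})·` the constant), **`exists_combGauge_linAvg_eq_smul_bondAvg`**.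

References: T. Bałaban, CMP 95 (1984) 17–40 [Balaban1984PropagatorsI] ((1.9)–(1.13) p.19); CMP 98 (1985) 17–51 [Balaban1985Averaging] ((62) p.28, (124)–(125) p.36);
CMP 102 (1985) 277–309 [Balaban1985Variational] ((4) p.278); CMP 109 (1987) 249–301 [Balaban1987RG1] ((0.3)–(0.4) p.252).
-/

noncomputable section

open scoped BigOperators Matrix.Norms.L2Operator Matrix

namespace Summit.QuantumFields.YangMills.Theorems.Prop7CombGauge

open Literature.MathematicalPhysics.QuantumFieldTheory.Balaban1983to89
open Finset T4Continuum AveragingRT BlockAveraging BlockAveragingEMLLinearised LatticeFieldCalculus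
open Summit.QuantumFields.YangMills.Theorems.Prop7LinAvgOnto (linAvg_add)

variable {P : Params} {j : ℕ}

/-! ## §1 Additivity of walk sums and comb means -/

/-- The signed sum along a walk is additive in the field. [folklore] -/
theorem walkSum_add {V : Type*} [AddCommGroup V] (Y Z : PBond P j → V) :
    ∀ γ : List (LStep P j), walkSum (fun b => Y b + Z b) γ = walkSum Y γ + walkSum Z γ
  | [] => by simp [walkSum_nil]
  | s :: γ => by
    rw [walkSum_cons, walkSum_cons, walkSum_cons, walkSum_add Y Z γ]
    split_ifs <;> abel

variable {n : Type*}

/-- The comb mean is additive in the field. [cite: Balaban1985Averaging, (62) p.28] -/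
theorem combMean_add (Y Z : PBond P j → Matrix n n ℂ) (y : Site P (j + 1)) :
    combMean (fun b => Y b + Z b) y = combMean Y y + combMean Z y := by
  rw [combMean_def, combMean_def, combMean_def, ← smul_add, ← Finset.sum_add_distrib]
  congr 1
  exact Finset.sum_congr rfl fun i _ => walkSum_add Y Z _

/-! ## §2 The comb mean of a pure gauge -/

/-- The block centre is the block site of offset `((L−1)/2, …, (L−1)/2)`. [cite: Balaban1987RG1, (0.1) p.252] -/
theorem emb_eq_blockSite (y : Site P (j + 1)) :
    emb y = Site.blockSite y fun _ => ⟨(P.L - 1) / 2, by have := P.L_pos; omega⟩ := by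
  funext μ; rfl

/-- **THE COMB MEAN OF A FINE PURE GAUGE IS THE BLOCK MEAN MINUS THE CENTRE VALUE**: `λ̄_{dλ}(y) = L^{−d}·Σ_{x∈B(y)}λ(x) − λ(emb y)` (telescoping along each staircase;
the index set of (0.4) covers the block sites uniformly). [cite: Balaban1984PropagatorsI, (1.9), (1.13) p.19] -/
theorem combMean_grad (lam : Site P j → Matrix n n ℂ) (y : Site P (j + 1)) :
    combMean (fun b : PBond P j => lam b.tgt - lam b.src) y
      = (((P.L : ℂ) ^ P.d)⁻¹) • (∑ r : Fin P.d → Fin P.L, lam (Site.blockSite y r)) - lam (emb y) := by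
  classical
  rw [combMean_def]
  simp only [walkSum_grad, walkEnd_emb_stairWord_eq_blockSite, Finset.sum_sub_distrib, Finset.sum_const, Finset.card_univ, smul_sub]
  haveI : Nonempty (Idx P) := inferInstance
  have hc : (Fintype.card (Idx P) : ℂ) ≠ 0 := Nat.cast_ne_zero.mpr Fintype.card_pos.ne'
  have hperm : (Fintype.card (Equiv.Perm (Fin P.d)) : ℂ) ≠ 0 := Nat.cast_ne_zero.mpr Fintype.card_pos.ne'
  congr 1
  · -- the sum over `I = offsets × orderings × orderings` of a function of the offset
    rw [Fintype.sum_prod_type, Finset.sum_congr rfl fun r _ => Fintype.sum_prod_type _]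
    simp only [Finset.sum_const, Finset.card_univ, smul_smul]
    rw [← Finset.smul_sum, ← Nat.cast_smul_eq_nsmul ℂ, smul_smul]
    congr 1
    rw [Fintype.card_prod, Fintype.card_prod, Fintype.card_fun, Fintype.card_fin, Fintype.card_fin]
    push_cast
    field_simp
  · rw [← Nat.cast_smul_eq_nsmul ℂ, smul_smul, inv_mul_cancel₀ hc, one_smul]

/-- The comb mean of `dλ` for `λ` BLOCK-CONSTANT OFF THE CENTRES and `0` AT THE CENTRES: `λ̄_{dλ}(y) = (1 − L^{−d})·C(y)`. [folklore] -/
theorem combMean_blockConst_off_centre (hj : j + 1 ≤ P.m + P.K) (C : Site P (j + 1) → Matrix n n ℂ) (y : Site P (j + 1)) :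
    combMean (fun b : PBond P j => (if b.tgt = emb (blockOf b.tgt) then 0 else C (blockOf b.tgt)) - (if b.src = emb (blockOf b.src) then 0 else C (blockOf b.src))) y
      = (1 - ((P.L : ℂ) ^ P.d)⁻¹) • C y := by
  classical
  rw [combMean_grad (fun x => if x = emb (blockOf x) then 0 else C (blockOf x)) y]
  set r₀ : Fin P.d → Fin P.L := fun _ => ⟨(P.L - 1) / 2, by have := P.L_pos; omega⟩ with hr₀
  have hemb : emb y = Site.blockSite y r₀ := emb_eq_blockSite y
  -- the centre term vanishes
  have hcond : emb y = emb (blockOf (emb y)) := by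
    conv_rhs => rw [hemb, Site.blockOf_blockSite hj]
  have hcen : (if emb y = emb (blockOf (emb y)) then (0 : Matrix n n ℂ) else C (blockOf (emb y))) = 0 := by
    rw [if_pos hcond]
  -- the block sum: every offset but the centre one contributes `C y`
  have hterm : ∀ r : Fin P.d → Fin P.L, (if Site.blockSite y r = emb (blockOf (Site.blockSite y r)) then (0 : Matrix n n ℂ) else C (blockOf (Site.blockSite y r)))
      = if r = r₀ then 0 else C y := by
    intro r
    rw [Site.blockOf_blockSite hj, hemb]
    by_cases hr : r = r₀
    · rw [if_pos (by rw [hr]), if_pos hr]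
    · rw [if_neg (fun h => hr (blockSite_inj hj h).2), if_neg hr]
  simp only [hterm, hcen, sub_zero]
  rw [Finset.sum_ite, Finset.sum_const_zero, zero_add, Finset.sum_const]
  have hcard : ((univ : Finset (Fin P.d → Fin P.L)).filter fun r => ¬r = r₀).card = P.L ^ P.d - 1 := by
    rw [Finset.filter_ne', Finset.card_erase_of_mem (Finset.mem_univ _), Finset.card_univ, Fintype.card_fun, Fintype.card_fin, Fintype.card_fin]
  rw [hcard, ← Nat.cast_smul_eq_nsmul ℂ, smul_smul]
  congr 1
  have hL : ((P.L : ℂ) ^ P.d) ≠ 0 := pow_ne_zero _ (Nat.cast_ne_zero.mpr P.L_pos.ne')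
  have h1 : 1 ≤ P.L ^ P.d := Nat.one_le_pow _ _ P.L_pos
  rw [Nat.cast_sub h1]
  push_cast
  field_simp

/-! ## §3 The comb-mean gauge -/

/-- **THE COMB-MEAN GAUGE.**  For every fine field `Y` there is a gauge function `λ` VANISHING AT THE BLOCK CENTRES (the Lie algebra of print's group (4), `u↓ = 1`)
such that `Y + dλ` has comb mean zero at every block, and therefore the TRUE linearised one-step (0.4) average of `Y` is EXACTLY `L` times the STRAIGHT block
average (1.11) of `Y + dλ`: `linAvg Y = L·bondAvg(Y + dλ)` (flat background; `linAvg(dλ) = 0` for such `λ`).  Explicitly `λ = −(L^d/(L^d − 1))·λ̄_Y∘blockOf` off the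
centres. [cite: Balaban1985Averaging, (124)-(125) p.36; Balaban1984PropagatorsI, (1.11)-(1.13) p.19] -/
theorem exists_combGauge_linAvg_eq_smul_bondAvg (hj : j + 1 ≤ P.m + P.K) (Y : PBond P j → Matrix n n ℂ) :
    ∃ lam : Site P j → Matrix n n ℂ, (∀ y, lam (emb y) = 0) ∧
      (∀ y, combMean (fun b => Y b + (lam b.tgt - lam b.src)) y = 0) ∧
      ∀ c : PBond P (j + 1), linAvg Y c = ((P.L : ℕ) : ℂ) • bondAvg (fun b => Y b + (lam b.tgt - lam b.src)) c := by
  classical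
  have hL : ((P.L : ℂ) ^ P.d) ≠ 0 := pow_ne_zero _ (Nat.cast_ne_zero.mpr P.L_pos.ne')
  have hL1 : (1 - ((P.L : ℂ) ^ P.d)⁻¹) ≠ 0 := by
    have h2 : (2 : ℝ) ≤ (P.L : ℝ) ^ P.d := by
      have : (2 : ℝ) ≤ P.L := by exact_mod_cast P.hL.2
      calc (2 : ℝ) = 2 ^ 1 := by norm_num
        _ ≤ (P.L : ℝ) ^ 1 := by gcongr
        _ ≤ (P.L : ℝ) ^ P.d := pow_le_pow_right₀ (by linarith) P.hd
    have : ((P.L : ℂ) ^ P.d)⁻¹ ≠ 1 := by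
      intro h
      have h' : ((P.L : ℂ) ^ P.d) = 1 := by rw [← inv_inv ((P.L : ℂ) ^ P.d), h, inv_one]
      have : ((P.L : ℝ) ^ P.d) = 1 := by exact_mod_cast h'
      linarith
    exact sub_ne_zero.mpr (Ne.symm this)
  -- the gauge function: block-constant off the centres, `0` at the centres
  set C : Site P (j + 1) → Matrix n n ℂ := fun y => -((1 - ((P.L : ℂ) ^ P.d)⁻¹)⁻¹ • combMean Y y) with hC
  set lam : Site P j → Matrix n n ℂ := fun x => if x = emb (blockOf x) then 0 else C (blockOf x) with hlam
  have hlam_emb : ∀ y, lam (emb y) = 0 := fun y => by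
    have hcond : emb y = emb (blockOf (emb y)) := by
      conv_rhs => rw [emb_eq_blockSite y, Site.blockOf_blockSite hj]
    rw [hlam]; exact if_pos hcond
  have hzero : ∀ y, combMean (fun b => Y b + (lam b.tgt - lam b.src)) y = 0 := fun y => by
    rw [combMean_add, hlam, combMean_blockConst_off_centre hj C y, hC, smul_neg, smul_smul, mul_inv_cancel₀ hL1, one_smul, add_neg_cancel]
  refine ⟨lam, hlam_emb, hzero, fun c => ?_⟩
  have h1 := linAvg_eq_bondAvg_sub_grad_combMean (fun b => Y b + (lam b.tgt - lam b.src)) c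
  rw [hzero, hzero, sub_self, sub_zero] at h1
  have h2 := linAvg_add Y (fun b => lam b.tgt - lam b.src) c
  rw [linAvg_grad lam c, hlam_emb, hlam_emb, sub_self, add_zero] at h2
  rw [← h2, h1]

end Summit.QuantumFields.YangMills.Theorems.Prop7CombGauge

end
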